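import Summits.BirchSwinnertonDyer.BirchSwinnertonDyer.Theorems.ByReductionTypeAtTwoTorsionEulerCharB6DivisiblePart
import Literature.NumberTheory.EllipticCurves.IwasawaSelmerCoinvariantGrowthProofs
import Literature.NumberTheory.EllipticCurves.IwasawaSelmerDualProofs
import HarnessLib

set_option linter.dupNamespace false -- `…BirchSwinnertonDyer.BirchSwinnertonDyer…` is the cell's nested layout (D-0017)
set_option autoImplicit false

/-!
# Brick B6-S of the H46 kernel programme: STABILISATION of the divisible parts of `Sel_{p^∞}(E/K_∞)^{Γ_m}` for a torsion `X`

Cell `bsd-2adic` (run/shared/lean/pub/bsd-2adic/), seat `bsd-2adic-tower-1` GEN 36; `--supports stmt-BirchSwinnertonDyer-19271` (helper,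
item `OrdKatoHalfAtTwo`, TOWER road; roadmap `HOME/tower/gen36/NOTE-B6-UNIVERSAL-NORMS-GEN36.md` §2 (ii), §5′ (T-c), inputs (S1)/(S2)).
THEOREMS ONLY; closes no item; nothing booked; BSD is not proved by any of this.

Setting: any number field `K`, any `ℤ_p`-extension `κ` and `γ ∈ Γ_K` with a Pontryagin-dual datum `D : SelmerDualData W κ γ` whose
`X` is finitely generated and `Λ`-TORSION. Write `G_m = Sel_∞^{γ^{p^m}} ⊆ Sel_∞ = Sel_{p^∞}(E/K_∞)` (for `γ` a topological generator:
`= Sel_∞^{Γ_m}`). By the tree's bounded-corank theorem (`exists_natCard_fixedBy_torsion_le_of_isTorsion`: `#G_m[p^k] ≤ C(m)·p^{kB}`) and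
brick B6-P (divisible parts by counting):

* `exists_pow_smul_fixedBy_subset_fixedBy` — **for every step `a` and start `m₀` there are a level `n = m₀ + i·a` (`i ≤ p^B`) and an
  exponent `f` with `p^f · G_{n+a} ⊆ G_n`**: the divisible parts of `G_n ⊆ G_{n+a}` coincide (equal stable layers `E_∞`, pigeonhole on
  `#E_∞ ≤ p^B`), and `p^f G_{n+a}` is the divisible part of `G_{n+a}` (`f` its stable index).

This is the «stabilisation» input of the universal-norm argument: a class of `Sel_∞^{Γ_{n+a}}` that is `p^f`-divisible inside it is
already `Γ_n`-invariant. [cite: GreenbergLNM1716, §1 p. 62 (corank of Sel_E(F_∞)^{Γ_n} for a torsion X), §4 pp. 105–108]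
-/

noncomputable section

open scoped Classical

namespace Summit.BirchSwinnertonDyer.BirchSwinnertonDyer.Theorems

namespace TorsionEulerChar.B6

open Literature.NumberTheory.EllipticCurves WeierstrassCurve

variable {K : Type} [Field K] [NumberField K] (W : WeierstrassCurve K) (p : ℕ) [hp : Fact p.Prime]
  (κ : ZpExtension K p) {γ : Field.absoluteGaloisGroup K} (D : SelmerDualData W κ γ)

omit [NumberField K] in
/-- `conj_c ξ = ξ ⟹ conj_{c^n} ξ = ξ` on `H¹(K_∞, E[p^∞])`. [folklore] -/
private theorem conjH1_pow_apply_eq_self' {c : Field.absoluteGaloisGroup K} {ξ : W.subgroupH1 p κ.kerSubgroup}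
    (h : W.conjH1 p κ.kerSubgroup c ξ = ξ) (n : ℕ) : W.conjH1 p κ.kerSubgroup (c ^ n) ξ = ξ := by
  induction n with
  | zero => rw [pow_zero, W.conjH1_one_holds p κ.kerSubgroup]; rfl
  | succ n ih => rw [pow_succ, W.conjH1_mul_holds p κ.kerSubgroup, AddMonoidHom.comp_apply, h, ih]

/-- Every class of `Sel_∞` is killed by a power of `p`. [cite: GreenbergLNM1716, §1 (after Conj. 1.3)] -/
private theorem exists_pow_smul_selmerInfty_eq_zero (s : W.selmerInfty κ) : ∃ k : ℕ, p ^ k • s = 0 := by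
  obtain ⟨k, hk⟩ := W.exists_pow_smul_subgroupH1_ker_eq_zero (p := p) κ (s : W.subgroupH1 p κ.kerSubgroup)
  exact ⟨k, Subtype.ext (by rw [AddSubgroupClass.coe_nsmul]; exact hk)⟩

/-- **Stabilisation.** For `X(E/K_∞)` finitely generated and `Λ`-torsion, every step `a` and start `m₀`: there are `i ≤ p^B` and `f`
such that, with `n = m₀ + i·a`, every class `s ∈ Sel_∞` fixed by `γ^{p^{n+a}}` and `p^f`-divisible among such classes is fixed by
`γ^{p^n}`. (The invariants enter as a family of subgroups `G m` pinned by `hG`.) [cite: GreenbergLNM1716, §1 p. 62, §4 pp. 105–108] -/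
theorem exists_pow_smul_fixedBy_subset_fixedBy (hfg : Module.Finite (IwasawaAlgebra p) D.X) (hT : D.IsTorsion)
    (G : ℕ → AddSubgroup (W.selmerInfty κ))
    (hG : ∀ (m : ℕ) (s : W.selmerInfty κ), s ∈ G m ↔
      W.conjH1 p κ.kerSubgroup (γ ^ p ^ m) (s : W.subgroupH1 p κ.kerSubgroup) = s)
    (a m₀ : ℕ) :
    ∃ i f : ℕ, ∀ s ∈ G (m₀ + (i + 1) * a), (∃ y ∈ G (m₀ + (i + 1) * a), p ^ f • y = s) → s ∈ G (m₀ + i * a) := by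
  have hp1 : 1 < p := hp.out.one_lt
  -- p-primary
  have hprim : ∀ (m : ℕ) (x : W.selmerInfty κ), x ∈ G m → ∃ k : ℕ, p ^ k • x = 0 :=
    fun m x _ ↦ exists_pow_smul_selmerInfty_eq_zero W p κ x
  -- monotone
  have hmono : ∀ {m m' : ℕ}, m ≤ m' → G m ≤ G m' := by
    intro m m' hmm' s hs
    rw [hG] at hs ⊢
    obtain ⟨d, rfl⟩ := Nat.exists_eq_add_of_le hmm'
    rw [pow_add, pow_mul]
    exact conjH1_pow_apply_eq_self' W p κ hs _
  -- the growth bound: finiteness of every layer `G_m[p^k]` and `#G_m[p^k] ≤ C(m) p^{kB}`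
  obtain ⟨B, hB⟩ := D.exists_natCard_fixedBy_torsion_le_of_isTorsion hfg hT
  have hset : ∀ m k : ℕ, {s : W.selmerInfty κ | W.conjH1 p κ.kerSubgroup (γ ^ p ^ m)
      (s : W.subgroupH1 p κ.kerSubgroup) = s ∧ p ^ k • s = 0} = {x | x ∈ G m ∧ p ^ k • x = 0} := by
    intro m k; ext s; rw [Set.mem_setOf_eq, Set.mem_setOf_eq, hG]
  have hfin : ∀ m k : ℕ, {x : W.selmerInfty κ | x ∈ G m ∧ p ^ k • x = 0}.Finite := by
    intro m k
    obtain ⟨C, hC⟩ := hB m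
    rw [← hset]; exact (hC k).1
  have hgrowth : ∀ m : ℕ, ∃ C : ℕ, ∀ k : ℕ, Nat.card {x : W.selmerInfty κ | x ∈ G m ∧ p ^ k • x = 0} ≤ C * p ^ (k * B) := by
    intro m
    obtain ⟨C, hC⟩ := hB m
    exact ⟨C, fun k ↦ by rw [← hset]; exact (hC k).2⟩
  -- the layers `E m k` and their stable indices
  let E : ℕ → ℕ → Set (W.selmerInfty κ) := fun m k ↦ {x | ∃ y ∈ G m, p ^ (k + 1) • y = 0 ∧ p ^ k • y = x}
  have hE : ∀ (m k : ℕ) (x : W.selmerInfty κ), x ∈ E m k ↔ ∃ y ∈ G m, p ^ (k + 1) • y = 0 ∧ p ^ k • y = x :=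
    fun _ _ _ ↦ Iff.rfl
  have hst : ∀ m : ℕ, ∃ k₁ : ℕ, ∀ k : ℕ, k₁ ≤ k → E m k = E m k₁ := fun m ↦
    exists_layerImage_stable p (G m) (E m) (hE m) (by simpa only [pow_one] using hfin m 1)
  choose k₁ hk₁ using hst
  -- `F m := #E_∞(G_m) ≤ p^B`, monotone in `m`
  have hEfin : ∀ m k, (E m k).Finite := fun m k ↦
    (by simpa only [pow_one] using hfin m 1 : {x : W.selmerInfty κ | x ∈ G m ∧ p • x = 0}.Finite).subset
      (layerImage_subset_pTorsion p (G m) (E m) (hE m) k)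
  have hFle : ∀ m : ℕ, Nat.card (E m (k₁ m)) ≤ p ^ B := by
    intro m
    obtain ⟨C, hC⟩ := hgrowth m
    exact natCard_layerImage_le_of_growth p (G m) (E m) (hE m) hp1 (hfin m) (hk₁ m) hC
  have hEsub : ∀ {m m' : ℕ}, m ≤ m' → E m (k₁ m) ⊆ E m' (k₁ m') := by
    intro m m' hmm'
    let k := max (k₁ m) (k₁ m')
    rw [← hk₁ m k (le_max_left _ _), ← hk₁ m' k (le_max_right _ _)]
    exact layerImage_mono p (G m) (G m') (hmono hmm') (E m) (E m') (hE m) (hE m') k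
  have hFmono : Monotone fun m ↦ Nat.card (E m (k₁ m)) := by
    intro m m' hmm'
    haveI : Finite (E m' (k₁ m')) := hEfin m' _
    exact Nat.card_mono (hEfin m' _) (hEsub hmm')
  -- pigeonhole
  obtain ⟨i, -, hi⟩ := exists_step_eq_of_monotone_le (fun m ↦ Nat.card (E m (k₁ m))) hFmono hFle m₀ a
  set n := m₀ + i * a with hn
  set n' := m₀ + (i + 1) * a with hn'
  have hnn' : n ≤ n' := by rw [hn, hn']; nlinarith
  -- equal stable layers
  have hi' : (E n' (k₁ n')).ncard ≤ (E n (k₁ n)).ncard := by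
    have h : Nat.card (E n (k₁ n)) = Nat.card (E n' (k₁ n')) := hi
    rw [Nat.card_coe_set_eq, Nat.card_coe_set_eq] at h
    rw [h]
  have heq : E n (k₁ n) = E n' (k₁ n') := Set.eq_of_subset_of_ncard_le (hEsub hnn') hi' (hEfin n' _)
  refine ⟨i, k₁ n', fun s hs hdiv ↦ ?_⟩
  -- `s ∈ D' ⊆ D ⊆ G n`
  have hD' : ∀ x : W.selmerInfty κ, x ∈ {x | ∃ y ∈ G n', p ^ k₁ n' • y = x} ↔ ∃ y ∈ G n', p ^ k₁ n' • y = x :=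
    fun _ ↦ Iff.rfl
  have hD : ∀ x : W.selmerInfty κ, x ∈ {x | ∃ y ∈ G n, p ^ k₁ n • y = x} ↔ ∃ y ∈ G n, p ^ k₁ n • y = x :=
    fun _ ↦ Iff.rfl
  have hsub := divPart_subset_of_layerImage_eq p (G n) (G n') (hmono hnn') (E n) (E n') (hE n) (hE n') (hprim n) (hprim n')
    (hk₁ n) (hk₁ n') heq _ _ hD hD'
  have hsD' : s ∈ {x : W.selmerInfty κ | ∃ y ∈ G n', p ^ k₁ n' • y = x} := hdiv
  exact divPart_subset (p := p) (G := G n) (D := {x | ∃ y ∈ G n, p ^ k₁ n • y = x}) hD (hsub hsD')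


/-! ## Generic form (any monotone `p`-primary family with a growth bound) and the `Γ_m`-invariants family (appended) -/

/-- **Stabilisation, generic form.** For a monotone family `G₀ ≤ G₁ ≤ ⋯` of `p`-primary subgroups of an abelian group with a uniform
corank-type growth bound `#G_m[p^k] ≤ C(m)·p^{kB}` (all layers finite): for every step `a` and start `m₀` there are `i ≤ p^B` and `f`
with `p^f · G_{m₀+(i+1)a} ⊆ G_{m₀+ia}` (in the sense: an element of the later group that is `p^f`-divisible inside it lies in the
earlier one). [cite: GreenbergLNM1716, §1 p. 62, §4 pp. 105–108] -/
theorem exists_pow_smul_subset_of_growth {A : Type*} [AddCommGroup A] (G : ℕ → AddSubgroup A) (hmono : Monotone G)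
    (hprim : ∀ (m : ℕ) (x : A), x ∈ G m → ∃ k : ℕ, p ^ k • x = 0) {B : ℕ}
    (hbound : ∀ m : ℕ, ∃ C : ℕ, ∀ k : ℕ, {x : A | x ∈ G m ∧ p ^ k • x = 0}.Finite ∧
      Nat.card {x : A | x ∈ G m ∧ p ^ k • x = 0} ≤ C * p ^ (k * B))
    (a m₀ : ℕ) :
    ∃ i f : ℕ, ∀ s ∈ G (m₀ + (i + 1) * a), (∃ y ∈ G (m₀ + (i + 1) * a), p ^ f • y = s) → s ∈ G (m₀ + i * a) := by
  have hp1 : 1 < p := hp.out.one_lt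
  have hfin : ∀ m k : ℕ, {x : A | x ∈ G m ∧ p ^ k • x = 0}.Finite := fun m k ↦ by
    obtain ⟨C, hC⟩ := hbound m; exact (hC k).1
  have hgrowth : ∀ m : ℕ, ∃ C : ℕ, ∀ k : ℕ, Nat.card {x : A | x ∈ G m ∧ p ^ k • x = 0} ≤ C * p ^ (k * B) := fun m ↦ by
    obtain ⟨C, hC⟩ := hbound m; exact ⟨C, fun k ↦ (hC k).2⟩
  let E : ℕ → ℕ → Set A := fun m k ↦ {x | ∃ y ∈ G m, p ^ (k + 1) • y = 0 ∧ p ^ k • y = x}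
  have hE : ∀ (m k : ℕ) (x : A), x ∈ E m k ↔ ∃ y ∈ G m, p ^ (k + 1) • y = 0 ∧ p ^ k • y = x := fun _ _ _ ↦ Iff.rfl
  have hst : ∀ m : ℕ, ∃ k₁ : ℕ, ∀ k : ℕ, k₁ ≤ k → E m k = E m k₁ := fun m ↦
    exists_layerImage_stable p (G m) (E m) (hE m) (by simpa only [pow_one] using hfin m 1)
  choose k₁ hk₁ using hst
  have hEfin : ∀ m k, (E m k).Finite := fun m k ↦
    (by simpa only [pow_one] using hfin m 1 : {x : A | x ∈ G m ∧ p • x = 0}.Finite).subset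
      (layerImage_subset_pTorsion p (G m) (E m) (hE m) k)
  have hFle : ∀ m : ℕ, Nat.card (E m (k₁ m)) ≤ p ^ B := fun m ↦ by
    obtain ⟨C, hC⟩ := hgrowth m
    exact natCard_layerImage_le_of_growth p (G m) (E m) (hE m) hp1 (hfin m) (hk₁ m) hC
  have hEsub : ∀ {m m' : ℕ}, m ≤ m' → E m (k₁ m) ⊆ E m' (k₁ m') := by
    intro m m' hmm'
    let k := max (k₁ m) (k₁ m')
    rw [← hk₁ m k (le_max_left _ _), ← hk₁ m' k (le_max_right _ _)]
    exact layerImage_mono p (G m) (G m') (hmono hmm') (E m) (E m') (hE m) (hE m') k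
  have hFmono : Monotone fun m ↦ Nat.card (E m (k₁ m)) := by
    intro m m' hmm'
    haveI : Finite (E m' (k₁ m')) := hEfin m' _
    exact Nat.card_mono (hEfin m' _) (hEsub hmm')
  obtain ⟨i, -, hi⟩ := exists_step_eq_of_monotone_le (fun m ↦ Nat.card (E m (k₁ m))) hFmono hFle m₀ a
  set n := m₀ + i * a with hn
  set n' := m₀ + (i + 1) * a with hn'
  have hnn' : n ≤ n' := by rw [hn, hn']; nlinarith
  have hi' : (E n' (k₁ n')).ncard ≤ (E n (k₁ n)).ncard := by
    have h : Nat.card (E n (k₁ n)) = Nat.card (E n' (k₁ n')) := hi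
    rw [Nat.card_coe_set_eq, Nat.card_coe_set_eq] at h
    rw [h]
  have heq : E n (k₁ n) = E n' (k₁ n') := Set.eq_of_subset_of_ncard_le (hEsub hnn') hi' (hEfin n' _)
  refine ⟨i, k₁ n', fun s hs hdiv ↦ ?_⟩
  have hD' : ∀ x : A, x ∈ {x | ∃ y ∈ G n', p ^ k₁ n' • y = x} ↔ ∃ y ∈ G n', p ^ k₁ n' • y = x := fun _ ↦ Iff.rfl
  have hD : ∀ x : A, x ∈ {x | ∃ y ∈ G n, p ^ k₁ n • y = x} ↔ ∃ y ∈ G n, p ^ k₁ n • y = x := fun _ ↦ Iff.rfl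
  have hsub := divPart_subset_of_layerImage_eq p (G n) (G n') (hmono hnn') (E n) (E n') (hE n) (hE n') (hprim n) (hprim n')
    (hk₁ n) (hk₁ n') heq _ _ hD hD'
  have hsD' : s ∈ {x : A | ∃ y ∈ G n', p ^ k₁ n' • y = x} := hdiv
  exact divPart_subset (p := p) (G := G n) (D := {x | ∃ y ∈ G n, p ^ k₁ n • y = x}) hD (hsub hsD')

omit [NumberField K] in
/-- `γ^{pⁿ} ∈ κ⁻¹(pⁿℤ_p) = Gal(K̄/K_n)` for a topological generator `γ` (as `ZpExtension.pow_mem_layerSubgroup`). [folklore] -/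
private theorem pow_mem_layerSubgroup' (hγ : κ.IsTopGenerator γ) (n : ℕ) : γ ^ p ^ n ∈ κ.layerSubgroup n := by
  have hγ' : κ γ = Multiplicative.ofAdd 1 := hγ
  rw [ZpExtension.mem_layerSubgroup, map_pow, hγ', ← ofAdd_nsmul, toAdd_ofAdd, nsmul_eq_mul, mul_one, Nat.cast_pow]

/-- **Stabilisation for the `Γ_m`-invariants `Sel_∞^{Γ_m} = selmerInfty ⊓ layerInvariants m`** (the currency of Mazur control,
`W.selmer_control κ`): for `X(E/K_∞)` finitely generated and `Λ`-torsion and `γ` a topological generator, for every step `a` and start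
`m₀` there are `i ≤ p^B` and `f` such that, with `n = m₀ + i·a`, every class of `Sel_∞^{Γ_{n+a}}` that is `p^f`-divisible inside
`Sel_∞^{Γ_{n+a}}` lies in `Sel_∞^{Γ_n}` (the growth bound transfers from the `γ^{p^m}`-fixed classes, which contain `Sel_∞^{Γ_m}` as
`γ^{p^m} ∈ Γ_m`). [cite: GreenbergLNM1716, §1 p. 62, §4 pp. 105–108] -/
theorem exists_pow_smul_layerInvariants_subset (hfg : Module.Finite (IwasawaAlgebra p) D.X) (hT : D.IsTorsion)
    (hγ : κ.IsTopGenerator γ) (G : ℕ → AddSubgroup (W.selmerInfty κ))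
    (hG : ∀ (m : ℕ) (s : W.selmerInfty κ), s ∈ G m ↔ (s : W.subgroupH1 p κ.kerSubgroup) ∈ W.layerInvariants κ m)
    (a m₀ : ℕ) :
    ∃ i f : ℕ, ∀ s ∈ G (m₀ + (i + 1) * a), (∃ y ∈ G (m₀ + (i + 1) * a), p ^ f • y = s) → s ∈ G (m₀ + i * a) := by
  -- monotone: `Γ_{m'} ≤ Γ_m`
  have hmono : Monotone G := by
    intro m m' hmm' s hs
    rw [hG, mem_layerInvariants_iff] at hs ⊢
    exact fun σ hσ ↦ hs σ (κ.layerSubgroup_antitone hmm' hσ)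
  have hprim : ∀ (m : ℕ) (x : W.selmerInfty κ), x ∈ G m → ∃ k : ℕ, p ^ k • x = 0 :=
    fun m x _ ↦ exists_pow_smul_selmerInfty_eq_zero W p κ x
  -- growth bound by comparison with the `γ^{p^m}`-fixed classes
  obtain ⟨B, hB⟩ := D.exists_natCard_fixedBy_torsion_le_of_isTorsion hfg hT
  have hsub : ∀ m k : ℕ, {x : W.selmerInfty κ | x ∈ G m ∧ p ^ k • x = 0} ⊆
      {s : W.selmerInfty κ | W.conjH1 p κ.kerSubgroup (γ ^ p ^ m) (s : W.subgroupH1 p κ.kerSubgroup) = s ∧ p ^ k • s = 0} := by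
    intro m k x hx
    refine ⟨?_, hx.2⟩
    have h := (hG m x).1 hx.1
    rw [mem_layerInvariants_iff] at h
    exact h _ (pow_mem_layerSubgroup' p κ hγ m)
  have hbound : ∀ m : ℕ, ∃ C : ℕ, ∀ k : ℕ, {x : W.selmerInfty κ | x ∈ G m ∧ p ^ k • x = 0}.Finite ∧
      Nat.card {x : W.selmerInfty κ | x ∈ G m ∧ p ^ k • x = 0} ≤ C * p ^ (k * B) := by
    intro m
    obtain ⟨C, hC⟩ := hB m
    refine ⟨C, fun k ↦ ⟨(hC k).1.subset (hsub m k), ?_⟩⟩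
    haveI : Finite {s : W.selmerInfty κ | W.conjH1 p κ.kerSubgroup (γ ^ p ^ m) (s : W.subgroupH1 p κ.kerSubgroup) = s ∧
      p ^ k • s = 0} := (hC k).1
    exact (Nat.card_mono (hC k).1 (hsub m k)).trans (hC k).2
  exact exists_pow_smul_subset_of_growth p G hmono hprim hbound a m₀
end TorsionEulerChar.B6

end Summit.BirchSwinnertonDyer.BirchSwinnertonDyer.Theorems
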